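import Mathlib
import Summits.ValiantsHypothesis.ValiantsHypothesis.Theorems.RigidityForcesSymmetryRankRigidMinimalReprLaplaceFiveSeparatedCaptureSliceChain
import Summits.ValiantsHypothesis.ValiantsHypothesis.Theorems.RigidityForcesSymmetryRankRigidMinimalReprLaplaceFiveSeparatedCaptureRelabel
import Summits.ValiantsHypothesis.ValiantsHypothesis.Theorems.RigidityForcesSymmetryRankRigidMinimalReprLaplaceFiveSeparatedCaptureEqualLinesMem

/-!
# Rows of a coordinate slice: the slice chains fed by the row spaces of the joint span

A refinement of the feeding lemmas of the slice chains (✓ `finrank_le_of_two_zero_rows_01` &c.) for the 3-slot capture inequality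
`CaptureIneqSym` (item 24813 stays OPEN; nothing here claims it).

Write an obligation as `T_μ = 3·Sym(A) + G` with `A` the `U₀₁`-placed part and `G ∈ prolong X`, `X = U₀₁ ⊔ U₀₂ ⊔ U₁₂` (✓ residue
theorem `sub_symPlaced_mem_prolong`).  The new remark: EVERY ROW of a slice `G(c)` of a prolongation element is a `c`-th row of a
member of `X` — it lies in `rowIm X c`.  Hence at a letter `c` killed by `U₀₁` the coordinate slice of `T_μ` is `v + N` with
`v ∈ U₀₁` and `N ∈ X` ALL OF WHOSE ROWS LIE IN `rowIm X c`; when few members of `X` touch the letter `c` this is a much smaller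
space than `X` (e.g. `rowIm X c = ⊥` forces `N`'s rows to vanish: the slice lies in `U₀₁`).

* `prolong_slice_row_mem` — rows of slices of `G ∈ prolong X` lie in `rowIm X c`;
* `sliceCoord_residue_01/_02/_12` — the slice at a killed letter is `v + N`, `v` in the slot, `N ∈ X` with rows in `rowIm X c`;
* CONFIGURATIONS MISSING A LETTER.  If NO member of `X` touches the letter `c`, the `c`-slice of every obligation lies in
  `U₀₁ ⊓ U₀₂ ⊓ U₁₂` (`sliceCoord_mem_inf_of_untouched`); hence `finrank W ≤ finrank (U₀₁ ⊓ U₀₂ ⊓ U₁₂) + 4`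
  (`finrank_le_of_untouched_letter`, tight) and, with two untouched letters, `finrank W ≤ 2·finrank (U₀₁ ⊓ U₀₂ ⊓ U₁₂) + 1`
  (`finrank_le_of_two_untouched_letters`, tight: the atoms).  Consequences: `CaptureIneqSym` holds for EVERY configuration of three
  symmetric spans supported on three letters (`captureIneqSym_of_two_untouched_letters`), for every configuration supported on
  four letters with `Σ finrank ≥ 5` (`captureIneqSym_of_untouched_letter`), hence — the small profiles being ✓ `captureIneqSym_of_one_bot`
  / ✓ `captureIneqSym_of_two_lines_le_three` / ✓ `_01_12` / ✓ `_02_12` — for EVERY CONFIGURATION SUPPORTED ON FOUR LETTERS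
  (`captureIneqSym_of_four_letters`).  (The chains fed with the row information follow in a separate file.)

All [folklore] linear algebra; `CaptureIneqSym` in general, K1 on `K₃ ⊔ K₂` and item 24813 remain OPEN.
-/

set_option linter.dupNamespace false
set_option autoImplicit false

namespace Summit.ValiantsHypothesis.ValiantsHypothesis.Theorems.RigidityForcesSymmetryRankRigidMinimalRepr

namespace LaplaceFiveSeparatedCapture

open Finset

/-! ### Rows of the slices of a prolongation element -/

/-- ★ For `G ∈ prolong X`, every row `q ↦ G p q c` of the `c`-slice `(p, q) ↦ G p q c` is the `c`-th row of the member `G p` of `X`: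
it lies in `rowIm X c`. [folklore] -/
theorem prolong_slice_row_mem (X : Submodule ℂ (Fin 5 → Fin 5 → ℂ)) {G : Fin 5 → Fin 5 → Fin 5 → ℂ} (hG : G ∈ prolong X)
    (c p : Fin 5) : (fun q => G p q c) ∈ rowIm X c := by
  obtain ⟨-, h23, hsl⟩ := (mem_prolong_iff X G).mp hG
  have e : (fun q => G p q c) = (G p) c := by
    funext q
    exact h23 p q c
  rw [e]
  exact ⟨G p, hsl p, rfl⟩

/-! ### The coordinate slice at a killed letter: slot part plus a member of `X` with rows in `rowIm X c` -/

/-- ★★ **RESIDUE FORM OF A COORDINATE SLICE, slot `01`.**  If every matrix of `U₀₁` has row `c` zero, the `c`-slice of an obligation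
captured by `L3 U₀₁ U₀₂ U₁₂` is `v + N` with `v ∈ U₀₁`, `N ∈ X = U₀₁ ⊔ U₀₂ ⊔ U₁₂` and every row of `N` in `rowIm X c`. [folklore] -/
theorem sliceCoord_residue_01 (U01 U02 U12 : Submodule ℂ (Fin 5 → Fin 5 → ℂ))
    (h01 : ∀ x ∈ U01, ∀ p q : Fin 5, x p q = x q p) (h02 : ∀ x ∈ U02, ∀ p q : Fin 5, x p q = x q p)
    (h12 : ∀ x ∈ U12, ∀ p q : Fin 5, x p q = x q p) (c : Fin 5) (hrow : ∀ x ∈ U01, ∀ q : Fin 5, x c q = 0)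
    (μ : Fin 5 → Fin 5 → ℂ) (hμ : contractZ μ ∈ L3 U01 U02 U12) :
    ∃ v ∈ U01, ∃ N ∈ U01 ⊔ U02 ⊔ U12, (∀ p : Fin 5, (fun q => N p q) ∈ rowIm (U01 ⊔ U02 ⊔ U12) c) ∧
      (fun p q => contractZ μ p q c) = v + N := by
  obtain ⟨A, B, C, hA, hB, hC, hT⟩ := L3_finite_form U01 U02 U12 hμ
  have hres := (sub_symPlaced_mem_prolong U01 U02 U12 A B C (contractZ μ) hA hB hC
    (fun r p q => h01 _ (hA r) p q) (fun r p q => h02 _ (hB r) p q) (fun r p q => h12 _ (hC r) p q) hT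
    (fun p q r => contractZ_swap12 μ p q r) (fun p q r => contractZ_swap23 μ p q r)).2.2
  refine ⟨A c, hA c, fun p q => (contractZ μ - fun p q r => A r p q + A q p r + A p q r) p q c,
    slice_last_mem_of_mem_prolong _ hres c, fun p => prolong_slice_row_mem _ hres c p, ?_⟩
  funext p q
  simp only [Pi.add_apply, Pi.sub_apply]
  have h1 : A q p c = 0 := by rw [h01 _ (hA q) p c]; exact hrow _ (hA q) p
  have h2 : A p q c = 0 := by rw [h01 _ (hA p) q c]; exact hrow _ (hA p) q
  rw [h1, h2]; ring

/-- ★★ **RESIDUE FORM OF A COORDINATE SLICE, slot `02`.** [folklore] -/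
theorem sliceCoord_residue_02 (U01 U02 U12 : Submodule ℂ (Fin 5 → Fin 5 → ℂ))
    (h01 : ∀ x ∈ U01, ∀ p q : Fin 5, x p q = x q p) (h02 : ∀ x ∈ U02, ∀ p q : Fin 5, x p q = x q p)
    (h12 : ∀ x ∈ U12, ∀ p q : Fin 5, x p q = x q p) (c : Fin 5) (hrow : ∀ x ∈ U02, ∀ q : Fin 5, x c q = 0)
    (μ : Fin 5 → Fin 5 → ℂ) (hμ : contractZ μ ∈ L3 U01 U02 U12) :
    ∃ v ∈ U02, ∃ N ∈ U01 ⊔ U02 ⊔ U12, (∀ p : Fin 5, (fun q => N p q) ∈ rowIm (U01 ⊔ U02 ⊔ U12) c) ∧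
      (fun p q => contractZ μ p q c) = v + N := by
  obtain ⟨A, B, C, hA, hB, hC, hT⟩ := L3_finite_form U01 U02 U12 hμ
  have hres := (sub_symPlaced_mem_prolong U01 U02 U12 A B C (contractZ μ) hA hB hC
    (fun r p q => h01 _ (hA r) p q) (fun r p q => h02 _ (hB r) p q) (fun r p q => h12 _ (hC r) p q) hT
    (fun p q r => contractZ_swap12 μ p q r) (fun p q r => contractZ_swap23 μ p q r)).2.1
  refine ⟨B c, hB c, fun p q => (contractZ μ - fun p q r => B r p q + B q p r + B p q r) p q c,
    slice_last_mem_of_mem_prolong _ hres c, fun p => prolong_slice_row_mem _ hres c p, ?_⟩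
  funext p q
  simp only [Pi.add_apply, Pi.sub_apply]
  have h1 : B q p c = 0 := by rw [h02 _ (hB q) p c]; exact hrow _ (hB q) p
  have h2 : B p q c = 0 := by rw [h02 _ (hB p) q c]; exact hrow _ (hB p) q
  rw [h1, h2]; ring

/-- ★★ **RESIDUE FORM OF A COORDINATE SLICE, slot `12`.** [folklore] -/
theorem sliceCoord_residue_12 (U01 U02 U12 : Submodule ℂ (Fin 5 → Fin 5 → ℂ))
    (h01 : ∀ x ∈ U01, ∀ p q : Fin 5, x p q = x q p) (h02 : ∀ x ∈ U02, ∀ p q : Fin 5, x p q = x q p)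
    (h12 : ∀ x ∈ U12, ∀ p q : Fin 5, x p q = x q p) (c : Fin 5) (hrow : ∀ x ∈ U12, ∀ q : Fin 5, x c q = 0)
    (μ : Fin 5 → Fin 5 → ℂ) (hμ : contractZ μ ∈ L3 U01 U02 U12) :
    ∃ v ∈ U12, ∃ N ∈ U01 ⊔ U02 ⊔ U12, (∀ p : Fin 5, (fun q => N p q) ∈ rowIm (U01 ⊔ U02 ⊔ U12) c) ∧
      (fun p q => contractZ μ p q c) = v + N := by
  obtain ⟨A, B, C, hA, hB, hC, hT⟩ := L3_finite_form U01 U02 U12 hμ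
  have hres := (sub_symPlaced_mem_prolong U01 U02 U12 A B C (contractZ μ) hA hB hC
    (fun r p q => h01 _ (hA r) p q) (fun r p q => h02 _ (hB r) p q) (fun r p q => h12 _ (hC r) p q) hT
    (fun p q r => contractZ_swap12 μ p q r) (fun p q r => contractZ_swap23 μ p q r)).1
  refine ⟨C c, hC c, fun p q => (contractZ μ - fun p q r => C r p q + C q p r + C p q r) p q c,
    slice_last_mem_of_mem_prolong _ hres c, fun p => prolong_slice_row_mem _ hres c p, ?_⟩
  funext p q
  simp only [Pi.add_apply, Pi.sub_apply]
  have h1 : C q p c = 0 := by rw [h12 _ (hC q) p c]; exact hrow _ (hC q) p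
  have h2 : C p q c = 0 := by rw [h12 _ (hC p) q c]; exact hrow _ (hC p) q
  rw [h1, h2]; ring

/-! ### Configurations missing a letter -/

/-- ★★ **A LETTER TOUCHED BY NO SPAN.**  If every member of `X = U₀₁ ⊔ U₀₂ ⊔ U₁₂` has row `c` zero, the `c`-slice of every captured
obligation lies in `U₀₁ ⊓ U₀₂ ⊓ U₁₂` (apply the residue form in each of the three slots: the `X`-part has its rows in
`rowIm X c = ⊥`). [folklore] -/
theorem sliceCoord_mem_inf_of_untouched (U01 U02 U12 : Submodule ℂ (Fin 5 → Fin 5 → ℂ))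
    (h01 : ∀ x ∈ U01, ∀ p q : Fin 5, x p q = x q p) (h02 : ∀ x ∈ U02, ∀ p q : Fin 5, x p q = x q p)
    (h12 : ∀ x ∈ U12, ∀ p q : Fin 5, x p q = x q p) (c : Fin 5)
    (hX : ∀ x ∈ U01 ⊔ U02 ⊔ U12, ∀ q : Fin 5, x c q = 0)
    (μ : Fin 5 → Fin 5 → ℂ) (hμ : contractZ μ ∈ L3 U01 U02 U12) :
    (fun p q => contractZ μ p q c) ∈ U01 ⊓ U02 ⊓ U12 := by
  have hN0 : ∀ N : Fin 5 → Fin 5 → ℂ, (∀ p : Fin 5, (fun q => N p q) ∈ rowIm (U01 ⊔ U02 ⊔ U12) c) → N = 0 := by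
    intro N hN
    funext p q
    obtain ⟨x, hx, hxe⟩ := hN p
    have := congrFun hxe q
    rw [Pi.zero_apply, ← this]
    exact hX x hx q
  have hle1 : U01 ≤ U01 ⊔ U02 ⊔ U12 := le_sup_left.trans le_sup_left
  have hle2 : U02 ≤ U01 ⊔ U02 ⊔ U12 := le_sup_right.trans le_sup_left
  have hle3 : U12 ≤ U01 ⊔ U02 ⊔ U12 := le_sup_right
  obtain ⟨v₁, hv₁, N₁, -, hN₁, e₁⟩ := sliceCoord_residue_01 U01 U02 U12 h01 h02 h12 c (fun x hx => hX x (hle1 hx)) μ hμ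
  obtain ⟨v₂, hv₂, N₂, -, hN₂, e₂⟩ := sliceCoord_residue_02 U01 U02 U12 h01 h02 h12 c (fun x hx => hX x (hle2 hx)) μ hμ
  obtain ⟨v₃, hv₃, N₃, -, hN₃, e₃⟩ := sliceCoord_residue_12 U01 U02 U12 h01 h02 h12 c (fun x hx => hX x (hle3 hx)) μ hμ
  rw [hN0 N₁ hN₁, add_zero] at e₁
  rw [hN0 N₂ hN₂, add_zero] at e₂
  rw [hN0 N₃ hN₃, add_zero] at e₃
  refine Submodule.mem_inf.mpr ⟨Submodule.mem_inf.mpr ⟨?_, ?_⟩, ?_⟩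
  · rw [e₁]; exact hv₁
  · rw [e₂]; exact hv₂
  · rw [e₃]; exact hv₃

/-- A symmetric zero-diagonal matrix with rows `c₁, c₂` zero is determined by its three entries on the remaining letters
`a, b, e`. [folklore] -/
theorem eq_zero_of_rows_zero_of_three_entries (M : Fin 5 → Fin 5 → ℂ) (hs : ∀ p q : Fin 5, M p q = M q p)
    (hd : ∀ p : Fin 5, M p p = 0) (c₁ c₂ a b e : Fin 5) (hcov : ∀ x : Fin 5, x = c₁ ∨ x = c₂ ∨ x = a ∨ x = b ∨ x = e)
    (h₁ : ∀ q : Fin 5, M c₁ q = 0) (h₂ : ∀ q : Fin 5, M c₂ q = 0)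
    (hab : M a b = 0) (hae : M a e = 0) (hbe : M b e = 0) : M = 0 := by
  have hr : ∀ p q : Fin 5, (p = c₁ ∨ p = c₂) → M p q = 0 := by
    rintro p q (rfl | rfl)
    · exact h₁ q
    · exact h₂ q
  have hS : ∀ p q : Fin 5, (p = a ∨ p = b ∨ p = e) → (q = a ∨ q = b ∨ q = e) → M p q = 0 := by
    rintro p q (rfl | rfl | rfl) (rfl | rfl | rfl)
    · exact hd _
    · exact hab
    · exact hae
    · rw [hs]; exact hab
    · exact hd _
    · exact hbe
    · rw [hs]; exact hae
    · rw [hs]; exact hbe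
    · exact hd _
  funext p q
  rw [Pi.zero_apply, Pi.zero_apply]
  rcases hcov p with hp | hp | hp | hp | hp
  · exact hr p q (Or.inl hp)
  · exact hr p q (Or.inr hp)
  all_goals
    rcases hcov q with hq | hq | hq | hq | hq
    · rw [hs]; exact hr q p (Or.inl hq)
    · rw [hs]; exact hr q p (Or.inr hq)
    all_goals exact hS p q (by tauto) (by tauto)

/-- ★ **OBLIGATIONS AVOIDING A LETTER span at most 4 dimensions**: if the `c`-slice of every obligation of `W` vanishes, then
`finrank W ≤ 4` (the four square-free words in the other letters). [folklore] -/
theorem finrank_le_four_of_slice_eq_zero (W : Submodule ℂ (Fin 5 → Fin 5 → ℂ))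
    (hWs : ∀ μ ∈ W, ∀ s t : Fin 5, μ s t = μ t s) (hWd : ∀ μ ∈ W, ∀ s : Fin 5, μ s s = 0)
    (c d a b e : Fin 5) (hcov : ∀ x : Fin 5, x = c ∨ x = d ∨ x = a ∨ x = b ∨ x = e)
    (h0 : ∀ μ ∈ W, (fun p q => contractZ μ p q c) = 0) : Module.finrank ℂ W ≤ 4 := by
  -- evaluation at the four words avoiding `c`
  let ev : Fin 5 → Fin 5 → Fin 5 → ((Fin 5 → Fin 5 → Fin 5 → ℂ) →ₗ[ℂ] ℂ) := fun p q r =>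
    (LinearMap.proj r : (Fin 5 → ℂ) →ₗ[ℂ] ℂ).comp
      ((LinearMap.proj q : (Fin 5 → Fin 5 → ℂ) →ₗ[ℂ] (Fin 5 → ℂ)).comp
        (LinearMap.proj p : (Fin 5 → Fin 5 → Fin 5 → ℂ) →ₗ[ℂ] (Fin 5 → Fin 5 → ℂ)))
  let wd : Fin 4 → (Fin 5 → Fin 5 → Fin 5 → ℂ) →ₗ[ℂ] ℂ := ![ev a b d, ev a e d, ev b e d, ev a b e]
  let ρ : W →ₗ[ℂ] (Fin 4 → ℂ) := (LinearMap.pi wd).comp (cZ.comp W.subtype)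
  have hρ : ∀ (μ : W) (i : Fin 4), ρ μ i = wd i (contractZ (μ : Fin 5 → Fin 5 → ℂ)) := fun μ i => rfl
  have hinj : Function.Injective ρ := by
    rw [injective_iff_map_eq_zero]
    intro μ hμ
    have hv : ∀ i, wd i (contractZ (μ : Fin 5 → Fin 5 → ℂ)) = 0 := fun i => by rw [← hρ]; simp [hμ]
    have h1 : contractZ (μ : Fin 5 → Fin 5 → ℂ) a b d = 0 := hv 0
    have h2 : contractZ (μ : Fin 5 → Fin 5 → ℂ) a e d = 0 := hv 1
    have h3 : contractZ (μ : Fin 5 → Fin 5 → ℂ) b e d = 0 := hv 2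
    have h4 : contractZ (μ : Fin 5 → Fin 5 → ℂ) a b e = 0 := hv 3
    have hc : (fun p q => contractZ (μ : Fin 5 → Fin 5 → ℂ) p q c) = 0 := h0 _ μ.2
    -- the `d`-slice vanishes too
    obtain ⟨hs, hdg, hrd, -⟩ := sliceCoord_shape (μ : Fin 5 → Fin 5 → ℂ) d
    have hsl : (fun p q => contractZ (μ : Fin 5 → Fin 5 → ℂ) p q d) = 0 :=
      eq_zero_of_rows_zero_of_three_entries _ hs hdg c d a b e hcov
        (sliceCoord_row_eq_zero_of_slice_eq_zero _ c d hc) hrd h1 h2 h3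
    have hT := contractZ_eq_zero_of_two_slices (μ : Fin 5 → Fin 5 → ℂ) c d a b e hcov
      (fun p q => congrFun (congrFun hc p) q) (fun p q => congrFun (congrFun hsl p) q) h4
    have hμ0 : (μ : Fin 5 → Fin 5 → ℂ) = 0 :=
      hub_injective _ (hWs _ μ.2) (hWd _ μ.2) (fun p q => by simp [hT])
    exact Subtype.ext hμ0
  have := LinearMap.finrank_le_finrank_of_injective hinj
  simpa using this

/-- ★★★ **ONE UNTOUCHED LETTER: `finrank W ≤ finrank (U₀₁ ⊓ U₀₂ ⊓ U₁₂) + 4`.**  Three symmetric spans all of whose members have row `c`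
zero (the configuration lives on the other four letters), ANY finranks and position. (Tight: `W = t + 4` occurs.) [folklore] -/
theorem finrank_le_of_untouched_letter (U01 U02 U12 W : Submodule ℂ (Fin 5 → Fin 5 → ℂ))
    (h01 : ∀ x ∈ U01, ∀ p q : Fin 5, x p q = x q p) (h02 : ∀ x ∈ U02, ∀ p q : Fin 5, x p q = x q p)
    (h12 : ∀ x ∈ U12, ∀ p q : Fin 5, x p q = x q p)
    (c d a b e : Fin 5) (hcov : ∀ x : Fin 5, x = c ∨ x = d ∨ x = a ∨ x = b ∨ x = e)
    (hX : ∀ x ∈ U01 ⊔ U02 ⊔ U12, ∀ q : Fin 5, x c q = 0)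
    (hWs : ∀ μ ∈ W, ∀ s t : Fin 5, μ s t = μ t s) (hWd : ∀ μ ∈ W, ∀ s : Fin 5, μ s s = 0)
    (hWc : ∀ μ ∈ W, contractZ μ ∈ L3 U01 U02 U12) :
    Module.finrank ℂ W ≤ Module.finrank ℂ (U01 ⊓ U02 ⊓ U12 : Submodule ℂ (Fin 5 → Fin 5 → ℂ)) + 4 := by
  let sl : (Fin 5 → Fin 5 → Fin 5 → ℂ) →ₗ[ℂ] (Fin 5 → Fin 5 → ℂ) :=
    { toFun := fun T p q => T p q c, map_add' := fun _ _ => rfl, map_smul' := fun _ _ => rfl }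
  let W' : Submodule ℂ (Fin 5 → Fin 5 → ℂ) := W ⊓ LinearMap.ker (sl.comp cZ)
  have hW'mem : ∀ μ : Fin 5 → Fin 5 → ℂ, μ ∈ W' ↔ μ ∈ W ∧ (fun p q => contractZ μ p q c) = 0 := fun μ => Iff.rfl
  have h1 := finrank_le_of_slice_step W W' (U01 ⊓ U02 ⊓ U12) c
    (fun μ hμ => sliceCoord_mem_inf_of_untouched U01 U02 U12 h01 h02 h12 c hX μ (hWc μ hμ))
    (fun μ hμ h0 => (hW'mem μ).mpr ⟨hμ, h0⟩)
  have h2 := finrank_le_four_of_slice_eq_zero W' (fun μ hμ => hWs μ ((hW'mem μ).mp hμ).1)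
    (fun μ hμ => hWd μ ((hW'mem μ).mp hμ).1) c d a b e hcov (fun μ hμ => ((hW'mem μ).mp hμ).2)
  omega

/-- ★★★ **TWO UNTOUCHED LETTERS: `finrank W ≤ 2·finrank (U₀₁ ⊓ U₀₂ ⊓ U₁₂) + 1`.**  Three symmetric spans living on three letters
(every member has rows `c₁, c₂` zero), ANY finranks. (Tight: the atoms `(ℂx_ab)³` have `W = 3`.) [folklore] -/
theorem finrank_le_of_two_untouched_letters (U01 U02 U12 W : Submodule ℂ (Fin 5 → Fin 5 → ℂ))
    (h01 : ∀ x ∈ U01, ∀ p q : Fin 5, x p q = x q p) (h02 : ∀ x ∈ U02, ∀ p q : Fin 5, x p q = x q p)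
    (h12 : ∀ x ∈ U12, ∀ p q : Fin 5, x p q = x q p)
    (c₁ c₂ a b e : Fin 5) (hcov : ∀ x : Fin 5, x = c₁ ∨ x = c₂ ∨ x = a ∨ x = b ∨ x = e)
    (hX₁ : ∀ x ∈ U01 ⊔ U02 ⊔ U12, ∀ q : Fin 5, x c₁ q = 0) (hX₂ : ∀ x ∈ U01 ⊔ U02 ⊔ U12, ∀ q : Fin 5, x c₂ q = 0)
    (hWs : ∀ μ ∈ W, ∀ s t : Fin 5, μ s t = μ t s) (hWd : ∀ μ ∈ W, ∀ s : Fin 5, μ s s = 0)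
    (hWc : ∀ μ ∈ W, contractZ μ ∈ L3 U01 U02 U12) :
    Module.finrank ℂ W ≤ 2 * Module.finrank ℂ (U01 ⊓ U02 ⊓ U12 : Submodule ℂ (Fin 5 → Fin 5 → ℂ)) + 1 := by
  have h := finrank_le_of_two_slices_chain W (U01 ⊓ U02 ⊓ U12) (U01 ⊓ U02 ⊓ U12) hWs hWd c₁ c₂ a b e hcov
    (fun μ hμ => sliceCoord_mem_inf_of_untouched U01 U02 U12 h01 h02 h12 c₁ hX₁ μ (hWc μ hμ))
    (fun μ hμ _ => sliceCoord_mem_inf_of_untouched U01 U02 U12 h01 h02 h12 c₂ hX₂ μ (hWc μ hμ))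
  omega

/-- ★★★ **`CaptureIneqSym` FOR EVERY CONFIGURATION ON THREE LETTERS** (two letters touched by no span; any finranks, any position).
[folklore] -/
theorem captureIneqSym_of_two_untouched_letters (U01 U02 U12 W : Submodule ℂ (Fin 5 → Fin 5 → ℂ))
    (h01 : ∀ x ∈ U01, ∀ p q : Fin 5, x p q = x q p) (h02 : ∀ x ∈ U02, ∀ p q : Fin 5, x p q = x q p)
    (h12 : ∀ x ∈ U12, ∀ p q : Fin 5, x p q = x q p)
    (c₁ c₂ a b e : Fin 5) (hcov : ∀ x : Fin 5, x = c₁ ∨ x = c₂ ∨ x = a ∨ x = b ∨ x = e)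
    (hX₁ : ∀ x ∈ U01 ⊔ U02 ⊔ U12, ∀ q : Fin 5, x c₁ q = 0) (hX₂ : ∀ x ∈ U01 ⊔ U02 ⊔ U12, ∀ q : Fin 5, x c₂ q = 0)
    (hWs : ∀ μ ∈ W, ∀ s t : Fin 5, μ s t = μ t s) (hWd : ∀ μ ∈ W, ∀ s : Fin 5, μ s s = 0)
    (hWc : ∀ μ ∈ W, contractZ μ ∈ L3 U01 U02 U12) :
    Module.finrank ℂ W ≤ Module.finrank ℂ U01 + Module.finrank ℂ U02 + Module.finrank ℂ U12 := by
  by_cases h3 : U12 = ⊥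
  · subst h3
    exact (captureIneqSym_of_third_bot U01 U02 W h01 h02 hWs hWd hWc).trans (by simp)
  have h := finrank_le_of_two_untouched_letters U01 U02 U12 W h01 h02 h12 c₁ c₂ a b e hcov hX₁ hX₂ hWs hWd hWc
  have t1 : Module.finrank ℂ (U01 ⊓ U02 ⊓ U12 : Submodule ℂ (Fin 5 → Fin 5 → ℂ)) ≤ Module.finrank ℂ U01 :=
    Submodule.finrank_mono (inf_le_left.trans inf_le_left)
  have t2 : Module.finrank ℂ (U01 ⊓ U02 ⊓ U12 : Submodule ℂ (Fin 5 → Fin 5 → ℂ)) ≤ Module.finrank ℂ U02 :=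
    Submodule.finrank_mono (inf_le_left.trans inf_le_right)
  have t3 : Module.finrank ℂ (U01 ⊓ U02 ⊓ U12 : Submodule ℂ (Fin 5 → Fin 5 → ℂ)) ≤ Module.finrank ℂ U12 :=
    Submodule.finrank_mono inf_le_right
  have h3' : 0 < Module.finrank ℂ U12 := by
    rw [pos_iff_ne_zero]
    exact fun h0 => h3 (Submodule.finrank_eq_zero.mp h0)
  omega

/-- ★★★ **`CaptureIneqSym` FOR EVERY CONFIGURATION ON FOUR LETTERS WITH `Σ finrank ≥ 5`** (one letter touched by no span; then
`finrank (U₀₁ ⊓ U₀₂ ⊓ U₁₂) + 4 ≤ Σ finrank U_i` automatically). [folklore] -/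
theorem captureIneqSym_of_untouched_letter (U01 U02 U12 W : Submodule ℂ (Fin 5 → Fin 5 → ℂ))
    (h01 : ∀ x ∈ U01, ∀ p q : Fin 5, x p q = x q p) (h02 : ∀ x ∈ U02, ∀ p q : Fin 5, x p q = x q p)
    (h12 : ∀ x ∈ U12, ∀ p q : Fin 5, x p q = x q p)
    (c d a b e : Fin 5) (hcov : ∀ x : Fin 5, x = c ∨ x = d ∨ x = a ∨ x = b ∨ x = e)
    (hX : ∀ x ∈ U01 ⊔ U02 ⊔ U12, ∀ q : Fin 5, x c q = 0)
    (h5 : 5 ≤ Module.finrank ℂ U01 + Module.finrank ℂ U02 + Module.finrank ℂ U12)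
    (hWs : ∀ μ ∈ W, ∀ s t : Fin 5, μ s t = μ t s) (hWd : ∀ μ ∈ W, ∀ s : Fin 5, μ s s = 0)
    (hWc : ∀ μ ∈ W, contractZ μ ∈ L3 U01 U02 U12) :
    Module.finrank ℂ W ≤ Module.finrank ℂ U01 + Module.finrank ℂ U02 + Module.finrank ℂ U12 := by
  have h := finrank_le_of_untouched_letter U01 U02 U12 W h01 h02 h12 c d a b e hcov hX hWs hWd hWc
  have t1 : Module.finrank ℂ (U01 ⊓ U02 ⊓ U12 : Submodule ℂ (Fin 5 → Fin 5 → ℂ)) ≤ Module.finrank ℂ U01 :=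
    Submodule.finrank_mono (inf_le_left.trans inf_le_left)
  have t2 : Module.finrank ℂ (U01 ⊓ U02 ⊓ U12 : Submodule ℂ (Fin 5 → Fin 5 → ℂ)) ≤ Module.finrank ℂ U02 :=
    Submodule.finrank_mono (inf_le_left.trans inf_le_right)
  have t3 : Module.finrank ℂ (U01 ⊓ U02 ⊓ U12 : Submodule ℂ (Fin 5 → Fin 5 → ℂ)) ≤ Module.finrank ℂ U12 :=
    Submodule.finrank_mono inf_le_right
  omega

/-- ★★★ **`CaptureIneqSym` FOR EVERY CONFIGURATION SUPPORTED ON FOUR LETTERS** (one letter touched by no span; ANY finranks, any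
position): `Σ finrank ≥ 5` by `captureIneqSym_of_untouched_letter`; a `⊥` slot by ✓ `captureIneqSym_of_one_bot`; otherwise two slots
are lines and ✓ `captureIneqSym_of_two_lines_le_three` / ✓ `captureIneqSym_of_two_lines_01_12` / ✓ `_02_12` apply. [folklore] -/
theorem captureIneqSym_of_four_letters (U01 U02 U12 W : Submodule ℂ (Fin 5 → Fin 5 → ℂ))
    (h01 : ∀ x ∈ U01, ∀ p q : Fin 5, x p q = x q p) (h02 : ∀ x ∈ U02, ∀ p q : Fin 5, x p q = x q p)
    (h12 : ∀ x ∈ U12, ∀ p q : Fin 5, x p q = x q p)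
    (c d a b e : Fin 5) (hcov : ∀ x : Fin 5, x = c ∨ x = d ∨ x = a ∨ x = b ∨ x = e)
    (hX : ∀ x ∈ U01 ⊔ U02 ⊔ U12, ∀ q : Fin 5, x c q = 0)
    (hWs : ∀ μ ∈ W, ∀ s t : Fin 5, μ s t = μ t s) (hWd : ∀ μ ∈ W, ∀ s : Fin 5, μ s s = 0)
    (hWc : ∀ μ ∈ W, contractZ μ ∈ L3 U01 U02 U12) :
    Module.finrank ℂ W ≤ Module.finrank ℂ U01 + Module.finrank ℂ U02 + Module.finrank ℂ U12 := by
  by_cases h5 : 5 ≤ Module.finrank ℂ U01 + Module.finrank ℂ U02 + Module.finrank ℂ U12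
  · exact captureIneqSym_of_untouched_letter U01 U02 U12 W h01 h02 h12 c d a b e hcov hX h5 hWs hWd hWc
  by_cases hb : U01 = ⊥ ∨ U02 = ⊥ ∨ U12 = ⊥
  · exact captureIneqSym_of_one_bot U01 U02 U12 W h01 h02 h12 hb hWs hWd hWc
  push Not at hb h5
  obtain ⟨hb1, hb2, hb3⟩ := hb
  have p1 : 0 < Module.finrank ℂ U01 := pos_iff_ne_zero.mpr fun h0 => hb1 (Submodule.finrank_eq_zero.mp h0)
  have p2 : 0 < Module.finrank ℂ U02 := pos_iff_ne_zero.mpr fun h0 => hb2 (Submodule.finrank_eq_zero.mp h0)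
  have p3 : 0 < Module.finrank ℂ U12 := pos_iff_ne_zero.mpr fun h0 => hb3 (Submodule.finrank_eq_zero.mp h0)
  have line : ∀ U : Submodule ℂ (Fin 5 → Fin 5 → ℂ), U ≠ ⊥ → Module.finrank ℂ U ≤ 1 →
      ∃ u : Fin 5 → Fin 5 → ℂ, u ≠ 0 ∧ u ∈ U ∧ U = ℂ ∙ u :=
    fun U hU h1 => (eq_bot_or_line_of_finrank_le_one U h1).resolve_left hU
  rcases (by omega : (Module.finrank ℂ U01 ≤ 1 ∧ Module.finrank ℂ U02 ≤ 1) ∨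
      (Module.finrank ℂ U01 ≤ 1 ∧ Module.finrank ℂ U12 ≤ 1) ∨ (Module.finrank ℂ U02 ≤ 1 ∧ Module.finrank ℂ U12 ≤ 1))
    with ⟨e1, e2⟩ | ⟨e1, e3⟩ | ⟨e2, e3⟩
  · obtain ⟨u₁, hu₁, hu₁U, rfl⟩ := line U01 hb1 e1
    obtain ⟨u₂, hu₂, hu₂U, rfl⟩ := line U02 hb2 e2
    exact captureIneqSym_of_two_lines_le_three u₁ u₂ (h01 u₁ hu₁U) (h02 u₂ hu₂U) hu₁ hu₂ U12 W h12 (by omega) hWs hWd hWc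
  · obtain ⟨u₁, hu₁, hu₁U, rfl⟩ := line U01 hb1 e1
    obtain ⟨u₃, hu₃, hu₃U, rfl⟩ := line U12 hb3 e3
    exact captureIneqSym_of_two_lines_01_12 u₁ u₃ (h01 u₁ hu₁U) (h12 u₃ hu₃U) hu₁ hu₃ U02 W h02 (by omega) hWs hWd hWc
  · obtain ⟨u₂, hu₂, hu₂U, rfl⟩ := line U02 hb2 e2
    obtain ⟨u₃, hu₃, hu₃U, rfl⟩ := line U12 hb3 e3
    exact captureIneqSym_of_two_lines_02_12 u₂ u₃ (h02 u₂ hu₂U) (h12 u₃ hu₃U) hu₂ hu₃ U01 W h01 (by omega) hWs hWd hWc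

end LaplaceFiveSeparatedCapture

end Summit.ValiantsHypothesis.ValiantsHypothesis.Theorems.RigidityForcesSymmetryRankRigidMinimalRepr
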